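import Summits.CriticalPhenomena.PercolationContinuityZ3.Theorems.PercNearOneGluingNoHeavyPcintSignedConfigs
import HarnessLib

/-!
# CriticalPhenomena/PercolationContinuityZ3 — Theorems/PercNearOneGluingNoHeavyPcintSignedConfigGlue.lean: restriction and gluing of signed configurations along a part; lifting finsets of a part; the sign word splits at an initial segment

Lane prim-pcint, STRUCTURE rule «numerics ⇒ structure ⇒ conjecture» (prim-pcint-2 GEN 22); sequel of …PcintSignedConfigs, technical layer of the
forest decomposition behind law C5-L4c.  A configuration `c = (π, σ)` closed on a part `S` restricts to configurations on `↥S` and `↥Sᶜ`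
(`resC`, reusing `restr` of …PcintChordDiagrams) and is recovered by gluing them (`glueC`, `glueC_resC`); finsets of a part lift to
the ambient order (`up`) with closedness, convexity and weights preserved; and when the part `I` is an INITIAL SEGMENT the sign word of `c` is the
sign word on `I` followed by the sign word on `Iᶜ` (`sw_eq_append`).

HONEST FRAMING: elementary finite combinatorics.  No `sorry`; standard axioms.  Written by prim-pcint-2 gen 22 (prover-prim-pcint-2-g22-0), 2026-08-27.
-/

namespace Summit.CriticalPhenomena.PercolationContinuityZ3.Theorems.Pcint.ChordDiag

variable {α : Type*} [LinearOrder α] [Fintype α]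

/-! ### Lifting finsets of a part -/

/-- The lift of a finset of the part `↥S` to the ambient type. [folklore] -/
def up {S : Finset α} (J : Finset ↥S) : Finset α := J.map (Function.Embedding.subtype _)

variable {S : Finset α}

omit [LinearOrder α] [Fintype α] in
/-- Membership of a point of the part in the lift. [folklore] -/
theorem coe_mem_up {J : Finset ↥S} (a : ↥S) : (a : α) ∈ up J ↔ a ∈ J := by
  unfold up
  constructor
  · intro h
    obtain ⟨b, hb, hba⟩ := Finset.mem_map.1 h
    have : b = a := Subtype.ext hba
    exact this ▸ hb
  · intro h
    exact Finset.mem_map.2 ⟨a, h, rfl⟩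

omit [LinearOrder α] [Fintype α] in
/-- Membership in the lift. [folklore] -/
theorem mem_up {J : Finset ↥S} {x : α} : x ∈ up J ↔ ∃ h : x ∈ S, (⟨x, h⟩ : ↥S) ∈ J := by
  constructor
  · intro h
    obtain ⟨b, hb, rfl⟩ := Finset.mem_map.1 h
    exact ⟨b.2, hb⟩
  · rintro ⟨hx, h⟩
    exact (coe_mem_up ⟨x, hx⟩).2 h

omit [LinearOrder α] [Fintype α] in
/-- The lift lies in the part. [folklore] -/
theorem up_subset (J : Finset ↥S) : up J ⊆ S := fun _ hx => (mem_up.1 hx).1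

omit [LinearOrder α] [Fintype α] in
/-- The lift has the same size. [folklore] -/
theorem card_up (J : Finset ↥S) : (up J).card = J.card := Finset.card_map _

omit [LinearOrder α] [Fintype α] in
/-- The lift of everything is the part. [folklore] -/
theorem up_univ : up (Finset.univ : Finset ↥S) = S := by
  ext x
  rw [mem_up]
  exact ⟨fun ⟨h, _⟩ => h, fun h => ⟨h, Finset.mem_univ _⟩⟩

omit [LinearOrder α] [Fintype α] in
/-- The lift is everything iff the finset is. [folklore] -/
theorem up_eq_iff_eq_univ (J : Finset ↥S) : up J = S ↔ J = Finset.univ := by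
  constructor
  · intro h
    refine Finset.eq_univ_iff_forall.2 fun a => (coe_mem_up a).1 ?_
    rw [h]; exact a.2
  · rintro rfl; exact up_univ

omit [LinearOrder α] [Fintype α] in
/-- The lift is non-empty iff the finset is. [folklore] -/
theorem up_nonempty_iff (J : Finset ↥S) : (up J).Nonempty ↔ J.Nonempty := by
  simp [up]

omit [LinearOrder α] [Fintype α] in
/-- The lift is empty iff the finset is. [folklore] -/
theorem up_eq_empty_iff (J : Finset ↥S) : up J = ∅ ↔ J = ∅ := by
  simp [up]

omit [Fintype α] in
/-- Pushing a finset of the ambient type down to the part and up again gives its trace. [folklore] -/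
theorem up_subtype (K : Finset α) : up (K.subtype (· ∈ S)) = K.filter (· ∈ S) := by
  ext x
  rw [mem_up, Finset.mem_filter]
  constructor
  · rintro ⟨hx, h⟩; exact ⟨(Finset.mem_subtype.1 h), hx⟩
  · rintro ⟨hK, hx⟩; exact ⟨hx, Finset.mem_subtype.2 hK⟩

omit [Fintype α] in
/-- Convexity descends to the part when the part is convex. [folklore] -/
theorem convex_up_iff (hS : Convex S) (J : Finset ↥S) : Convex (up J) ↔ Convex J := by
  constructor
  · intro h x hx y hy t hxt hty
    exact (coe_mem_up t).1 (h ((coe_mem_up x).2 hx) ((coe_mem_up y).2 hy) hxt hty)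
  · intro h x hx y hy t hxt hty
    obtain ⟨hxS, hx'⟩ := mem_up.1 hx
    obtain ⟨hyS, hy'⟩ := mem_up.1 hy
    have htS : t ∈ S := hS hxS hyS hxt hty
    exact mem_up.2 ⟨htS, h hx' hy' (show (⟨x, hxS⟩ : ↥S) ≤ ⟨t, htS⟩ from hxt) (show (⟨t, htS⟩ : ↥S) ≤ ⟨y, hyS⟩ from hty)⟩

omit [Fintype α] in
/-- An initial segment of an initial segment is an initial segment. [folklore] -/
theorem init_up_iff (hS : Init S) (J : Finset ↥S) : Init (up J) ↔ Init J := by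
  constructor
  · intro h x hx y hyx
    exact (coe_mem_up y).1 (h ((coe_mem_up x).2 hx) hyx)
  · intro h x hx y hyx
    obtain ⟨hxS, hx'⟩ := mem_up.1 hx
    have hyS : y ∈ S := hS hxS hyx
    exact mem_up.2 ⟨hyS, h hx' (show (⟨y, hyS⟩ : ↥S) ≤ ⟨x, hxS⟩ from hyx)⟩

/-! ### Restriction and gluing -/

/-- Restriction of a configuration to a part. [folklore] -/
def resC (c : Cfg α) (S : Finset α) : Cfg ↥S := (restr c.1 S, fun x => c.2 x)

/-- Gluing a configuration on `↥Sᶜ` and one on `↥S`. [folklore] -/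
def glueC (S : Finset α) (cA : Cfg ↥(Sᶜ)) (cB : Cfg ↥S) : Cfg α :=
  (glue S cA.1 cB.1, fun x => if h : x ∈ S then cB.2 ⟨x, h⟩ else cA.2 ⟨x, Finset.mem_compl.2 h⟩)

variable {c : Cfg α} {cA : Cfg ↥(Sᶜ)} {cB : Cfg ↥S}

/-- The complement of a closed part is closed (involution). [folklore] -/
theorem IsCfg.closed_compl (h : IsCfg c) (hS : Closed c.1 S) : Closed c.1 Sᶜ := by
  intro t ht
  rw [Finset.mem_compl] at ht ⊢
  intro h'
  exact ht ((h.1 t) ▸ hS h')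

omit [Fintype α] in
/-- The restriction on a point of a closed part. [folklore] -/
theorem resC_fst_val (hS : Closed c.1 S) (x : ↥S) : (((resC c S).1 x : ↥S) : α) = c.1 x :=
  restr_val hS x

omit [Fintype α] in
/-- The sign of the restriction. [folklore] -/
theorem resC_snd (c : Cfg α) (S : Finset α) (x : ↥S) : (resC c S).2 x = c.2 x := rfl

omit [Fintype α] in
/-- Letters of the restriction. [folklore] -/
theorem resC_letter_iff (hS : Closed c.1 S) (x : ↥S) : (resC c S).1 x = x ↔ c.1 x = x := by
  rw [← Subtype.coe_inj, resC_fst_val hS]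

omit [Fintype α] in
/-- Point weights of the restriction. [folklore] -/
theorem sgn_resC (hS : Closed c.1 S) (x : ↥S) : sgn (resC c S) x = sgn c x := by
  unfold sgn
  by_cases h : c.1 x = x
  · rw [if_pos ((resC_letter_iff hS x).2 h), if_pos h]; rfl
  · rw [if_neg (fun h' => h ((resC_letter_iff hS x).1 h')), if_neg h]

omit [Fintype α] in
/-- Finset weights of the restriction. [folklore] -/
theorem wt_resC (hS : Closed c.1 S) (J : Finset ↥S) : wt (resC c S) J = wt c (up J) := by
  unfold wt up
  rw [Finset.sum_map]
  exact Finset.sum_congr rfl fun x _ => sgn_resC hS x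

omit [Fintype α] in
/-- Closed sets of the restriction. [folklore] -/
theorem closed_resC_iff (hS : Closed c.1 S) (J : Finset ↥S) : Closed (resC c S).1 J ↔ Closed c.1 (up J) := by
  constructor
  · intro h x hx
    obtain ⟨hxS, hx'⟩ := mem_up.1 hx
    have := h hx'
    rw [← coe_mem_up, resC_fst_val hS] at this
    exact this
  · intro h x hx
    have := h ((coe_mem_up x).2 hx)
    rw [← resC_fst_val hS, coe_mem_up] at this
    exact this

omit [Fintype α] in
/-- The restriction of a well-formed configuration to a closed part is well formed. [folklore] -/
theorem IsCfg.resC (h : IsCfg c) (hS : Closed c.1 S) : IsCfg (resC c S) := by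
  refine ⟨fun x => Subtype.ext ?_, fun x hx => ?_⟩
  · rw [resC_fst_val hS, resC_fst_val hS]; exact h.1 x
  · exact h.2 x fun h' => hx ((resC_letter_iff hS x).2 h')

/-- The glued map. [folklore] -/
theorem glueC_fst : (glueC S cA cB).1 = glue S cA.1 cB.1 := rfl

/-- The glued sign on the part. [folklore] -/
theorem glueC_snd_mem {x : α} (h : x ∈ S) : (glueC S cA cB).2 x = cB.2 ⟨x, h⟩ := by
  simp [glueC, h]

/-- The glued sign off the part. [folklore] -/
theorem glueC_snd_not_mem {x : α} (h : x ∉ S) : (glueC S cA cB).2 x = cA.2 ⟨x, Finset.mem_compl.2 h⟩ := by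
  simp [glueC, h]

/-- The glued configuration is closed on the part. [folklore] -/
theorem closed_glueC : Closed (glueC S cA cB).1 S := closed_glue

/-- The glued configuration is closed off the part. [folklore] -/
theorem closed_compl_glueC : Closed (glueC S cA cB).1 Sᶜ := closed_compl_glue

/-- Restricting a glued configuration to the part. [folklore] -/
theorem resC_glueC_right : resC (glueC S cA cB) S = cB := by
  refine Prod.ext restr_glue_right (funext fun x => ?_)
  show (glueC S cA cB).2 x = cB.2 x
  rw [glueC_snd_mem x.2]

/-- Restricting a glued configuration off the part. [folklore] -/
theorem resC_glueC_left : resC (glueC S cA cB) Sᶜ = cA := by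
  refine Prod.ext restr_glue_left (funext fun x => ?_)
  show (glueC S cA cB).2 x = cA.2 x
  rw [glueC_snd_not_mem (Finset.mem_compl.1 x.2)]

/-- A configuration closed on the part is the gluing of its restrictions. [folklore] -/
theorem glueC_resC (h : IsCfg c) (hS : Closed c.1 S) : glueC S (resC c Sᶜ) (resC c S) = c := by
  refine Prod.ext (funext fun x => ?_) (funext fun x => ?_)
  · show glue S (restr c.1 Sᶜ) (restr c.1 S) x = c.1 x
    by_cases hx : x ∈ S
    · rw [glue_apply_mem hx, restr_val hS]
    · rw [glue_apply_not_mem hx, restr_val (h.closed_compl hS)]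
  · by_cases hx : x ∈ S
    · rw [glueC_snd_mem hx]; rfl
    · rw [glueC_snd_not_mem hx]; rfl

/-- Gluing well-formed configurations gives a well-formed configuration. [folklore] -/
theorem IsCfg.glueC (hA : IsCfg cA) (hB : IsCfg cB) : IsCfg (glueC S cA cB) := by
  refine ⟨fun x => ?_, fun x hx => ?_⟩
  · show glue S cA.1 cB.1 (glue S cA.1 cB.1 x) = x
    by_cases hx : x ∈ S
    · rw [glue_apply_mem hx, glue_coe_mem]; exact congrArg Subtype.val (hB.1 ⟨x, hx⟩)
    · rw [glue_apply_not_mem hx, glue_coe_compl]; exact congrArg Subtype.val (hA.1 ⟨x, Finset.mem_compl.2 hx⟩)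
  · by_cases h : x ∈ S
    · rw [glueC_snd_mem h]
      refine hB.2 _ fun h' => hx ?_
      show glue S cA.1 cB.1 x = x
      rw [glue_apply_mem h, h']
    · rw [glueC_snd_not_mem h]
      refine hA.2 _ fun h' => hx ?_
      show glue S cA.1 cB.1 x = x
      rw [glue_apply_not_mem h, h']

/-! ### The sign word on a part; splitting at an initial segment -/

/-- Letters of the restriction, lifted: the letters inside the part. [folklore] -/
theorem up_letters_resC (hS : Closed c.1 S) : up (letters (resC c S)) = (letters c).filter (· ∈ S) := by
  ext x
  rw [mem_up, Finset.mem_filter, mem_letters]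
  constructor
  · rintro ⟨hx, h⟩
    exact ⟨(resC_letter_iff hS ⟨x, hx⟩).1 (mem_letters.1 h), hx⟩
  · rintro ⟨h, hx⟩
    exact ⟨hx, mem_letters.2 ((resC_letter_iff hS ⟨x, hx⟩).2 h)⟩

/-- The sign word of the restriction is read off the letters inside the part. [folklore] -/
theorem sw_resC (hS : Closed c.1 S) :
    sw (resC c S) = (((letters c).filter (· ∈ S)).sort (· ≤ ·)).map c.2 := by
  unfold sw
  rw [← up_letters_resC hS]
  unfold up
  rw [← Finset.map_sort (r := (· ≤ ·)) (r' := (· ≤ ·)) (f := Function.Embedding.subtype _) (s := letters (resC c S))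
    (fun a _ b _ => Iff.rfl), List.map_map]
  rfl

omit [Fintype α] in
/-- Sorting a finset split by a part lying below the rest of it: the part comes first. [folklore] -/
theorem sort_filter_append {I : Finset α} (L : Finset α) (hlt : ∀ a ∈ L, a ∈ I → ∀ b ∈ L, b ∉ I → a < b) :
    (L.filter (· ∈ I)).sort (· ≤ ·) ++ (L.filter (· ∉ I)).sort (· ≤ ·) = L.sort (· ≤ ·) := by
  apply List.SortedLT.eq_of_mem_iff
  · rw [List.sortedLT_iff_pairwise, List.pairwise_append]
    refine ⟨(Finset.sortedLT_sort _).pairwise, (Finset.sortedLT_sort _).pairwise, fun a ha b hb => ?_⟩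
    rw [Finset.mem_sort, Finset.mem_filter] at ha hb
    exact hlt a ha.1 ha.2 b hb.1 hb.2
  · exact Finset.sortedLT_sort _
  · intro a
    simp only [List.mem_append, Finset.mem_sort, Finset.mem_filter]
    tauto

/-- **The sign word splits at a closed part whose letters precede the other letters**: `sw c = sw (c|I) ++ sw (c|Iᶜ)`. [folklore] -/
theorem sw_eq_append' {I : Finset α} (h : IsCfg c) (hcl : Closed c.1 I)
    (hlt : ∀ a, c.1 a = a → a ∈ I → ∀ b, c.1 b = b → b ∉ I → a < b) : sw c = sw (resC c I) ++ sw (resC c Iᶜ) := by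
  rw [sw_resC hcl, sw_resC (h.closed_compl hcl), ← List.map_append]
  unfold sw
  congr 1
  rw [← sort_filter_append (letters c) fun a ha haI b hb hbI => hlt a (mem_letters.1 ha) haI b (mem_letters.1 hb) hbI]
  congr 2
  ext x; simp

/-- **The sign word splits at an initial segment**: `sw c = sw (c|I) ++ sw (c|Iᶜ)`. [folklore] -/
theorem sw_eq_append {I : Finset α} (hI : Init I) (h : IsCfg c) (hcl : Closed c.1 I) :
    sw c = sw (resC c I) ++ sw (resC c Iᶜ) :=
  sw_eq_append' h hcl fun _ _ haI _ _ hbI => lt_of_not_ge fun hba => hbI (hI haI hba)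

/-- The number of letters inside a closed part. [folklore] -/
theorem length_sw_resC (hS : Closed c.1 S) : (sw (resC c S)).length = ((letters c).filter (· ∈ S)).card := by
  rw [sw_resC hS, List.length_map, Finset.length_sort]

end Summit.CriticalPhenomena.PercolationContinuityZ3.Theorems.Pcint.ChordDiag
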